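import Summits.AtomisticToContinuum.HydrodynamicLimit.Theorems.EnergyCurrentTails.Negative.CubicTailExpMoment

/-!
# `EnergyCurrentTails` (stmt-AtomisticToContinuum-9235), negative knowledge 2/3: focusing witnesses — the randomness and the Gaussian form of the law are load-bearing

Load-bearing analysis of the crux `OneFlightGossipEngine.EnergyCurrentTails` by the standing
disprover (`Cruxes/EnergyCurrentTails/Disproof.lean`, refuter-cdisprove-stmt-AtomisticToContinuum-9235-0).

* `energyCurrentTails_false_without_randomness`: the crux with the expectation under the local Gibbs
  law replaced by a SURE statement over all configurations of kinetic energy `≤ E₀` per particle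
  (`EnergyCurrentTailsSure` — energy conservation is the only a priori information the deterministic
  flow propagates) is FALSE: one sphere with speed `√(N+1)` (`fastConfig`) has energy `1` per
  particle and cubic tail `√(N+1)` beyond every cut-off; the same INSIDE the hard-sphere domain at every
  `σ ≤ 1/2` (`energyCurrentTails_false_without_randomness_inDomain`, positions from
  `exists_config_hsDiameter_lt` — the hard core constrains positions, not velocities).
* `energyCurrentTails_false_of_quadraticUI_only`: cubic uniform integrability does NOT follow from
  uniform integrability of the kinetic energy of the laws (`EnergyCurrentTailsOfQuadraticUI`, all
  that energy conservation, the `O(N)` entropy budget and the convergence of the hydrodynamic fields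
  can see): the two-point laws `(1 - q_N) δ_rest + q_N δ_fast`, `q_N = (N+1)^{-1/2}`, have quadratic
  tails `≤ q_N → 0` at every cut-off and cubic tails `≡ 1`.

Companion file 3/3 (`CollisionFocusing`): no pathwise maximum principle and kinematic focusing
trees.  The crux itself is NOT refuted (see the Disproof workfile).
-/

noncomputable section

open MeasureTheory Filter Set Topology
open scoped ENNReal

namespace Summit.AtomisticToContinuum.HydrodynamicLimit.Theorems

namespace EnergyCurrentTailsNegative

open Literature.MathematicalPhysics.KineticTheory Literature.Analysis.FluidPDE


/-! ### The focusing configuration: one fast sphere -/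

/-- The unit vector `e₀` of `ℝ³` (direction of the fast sphere). -/
def e0 : V3 := EuclideanSpace.single 0 1

/-- The unit vector has norm one. -/
@[simp] theorem norm_e0 : ‖e0‖ = 1 := by
  simp [e0]

/-- The focusing configuration: all spheres at rest except sphere `0`, which moves with speed
`V` along `e₀` (positions irrelevant, all at the origin). -/
def fastConfig (N : ℕ) (V : ℝ) : Config (N + 1) (Fin 3) T3 :=
  fun i => ((0 : T3), if i = 0 then V • e0 else 0)

/-- The rest configuration. -/
def restConfig (N : ℕ) : Config (N + 1) (Fin 3) T3 := fun _ => ((0 : T3), (0 : V3))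

/-- Sums over the focusing configuration reduce to the fast sphere. -/
theorem sum_fastConfig {N : ℕ} (V : ℝ) (g : V3 → ℝ) (hg : g 0 = 0) :
    ∑ i : Fin (N + 1), g ((fastConfig N V i).2) = g (V • e0) := by
  rw [Finset.sum_eq_single (0 : Fin (N + 1))]
  · simp [fastConfig]
  · intro i _ hi
    simp [fastConfig, hi, hg]
  · intro h; exact absurd (Finset.mem_univ _) h

/-- Norm of a nonnegative multiple of `e₀`. -/
theorem norm_smul_e (V : ℝ) (hV : 0 ≤ V) : ‖V • e0‖ = V := by
  rw [norm_smul, norm_e0, mul_one, Real.norm_of_nonneg hV]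

/-- Kinetic energy per particle of the focusing configuration: `V²/(N+1)`. -/
theorem energy_fastConfig (N : ℕ) (V : ℝ) (hV : 0 ≤ V) :
    ((N : ℝ) + 1)⁻¹ * ∑ i : Fin (N + 1), ‖(fastConfig N V i).2‖ ^ 2 = ((N : ℝ) + 1)⁻¹ * V ^ 2 := by
  rw [sum_fastConfig V (fun v => ‖v‖ ^ 2) (by simp), norm_smul_e V hV]

/-- Cubic tail of the focusing configuration above the cut-off: `V³/(N+1)`. -/
theorem cubicTail_fastConfig {N : ℕ} {V M : ℝ} (hM : 0 ≤ M) (hV : M < V) :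
    cubicTail N M (fastConfig N V) = ((N : ℝ) + 1)⁻¹ * V ^ 3 := by
  unfold cubicTail
  rw [sum_fastConfig V (tail3 M) (tail3_zero M hM),
    tail3_of_lt (by rwa [norm_smul_e V (hM.trans hV.le)]), norm_smul_e V (hM.trans hV.le)]

/-- Quadratic tail of the focusing configuration: at most `V²/(N+1)`. -/
theorem quadTail_fastConfig_le {N : ℕ} {V M : ℝ} (hM : 0 ≤ M) (hV : 0 ≤ V) :
    quadTail N M (fastConfig N V) ≤ ((N : ℝ) + 1)⁻¹ * V ^ 2 := by
  unfold quadTail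
  rw [sum_fastConfig V (tail2 M) (tail2_zero M hM)]
  refine mul_le_mul_of_nonneg_left ?_ (by positivity)
  calc tail2 M (V • e0) ≤ ‖V • e0‖ ^ 2 := tail2_le M _
    _ = V ^ 2 := by rw [norm_smul_e V hV]

/-- The rest configuration has no cubic tail. -/
theorem cubicTail_restConfig (N : ℕ) {M : ℝ} (hM : 0 ≤ M) : cubicTail N M (restConfig N) = 0 := by
  unfold cubicTail restConfig
  simp [tail3_zero M hM]

/-- The rest configuration has no quadratic tail. -/
theorem quadTail_restConfig (N : ℕ) {M : ℝ} (hM : 0 ≤ M) : quadTail N M (restConfig N) = 0 := by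
  unfold quadTail restConfig
  simp [tail2_zero M hM]

/-- With `V = √(N+1)` (energy `1` per particle) the cubic tail of the focusing configuration is
`√(N+1)` as soon as the cut-off is below the fast speed. -/
theorem cubicTail_fastConfig_sqrt {N : ℕ} {M : ℝ} (hM : 0 ≤ M) (hV : M < Real.sqrt ((N : ℝ) + 1)) :
    cubicTail N M (fastConfig N (Real.sqrt ((N : ℝ) + 1))) = Real.sqrt ((N : ℝ) + 1) := by
  rw [cubicTail_fastConfig hM hV]
  have hN : (0 : ℝ) ≤ (N : ℝ) + 1 := by positivity
  have hN' : (N : ℝ) + 1 ≠ 0 := by positivity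
  have h3 : Real.sqrt ((N : ℝ) + 1) ^ 3 = ((N : ℝ) + 1) * Real.sqrt ((N : ℝ) + 1) := by
    rw [pow_succ, Real.sq_sqrt hN]
  rw [h3, ← mul_assoc, inv_mul_cancel₀ hN', one_mul]

/-- A natural number beyond `N₀` whose successor has square root above `M` (and above `2`). -/
theorem exists_sqrt_gt (M : ℝ) (N₀ : ℕ) :
    ∃ N : ℕ, N₀ ≤ N ∧ M < Real.sqrt ((N : ℝ) + 1) ∧ 2 < Real.sqrt ((N : ℝ) + 1) := by
  refine ⟨N₀ + (⌈|M|⌉₊ + 3) ^ 2, Nat.le_add_right _ _, ?_, ?_⟩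
  · have h1 : |M| < Real.sqrt (((N₀ + (⌈|M|⌉₊ + 3) ^ 2 : ℕ) : ℝ) + 1) := by
      rw [Real.lt_sqrt (abs_nonneg M)]
      push_cast
      nlinarith [Nat.le_ceil (|M|), abs_nonneg M, (Nat.cast_nonneg N₀ : (0:ℝ) ≤ N₀)]
    exact (le_abs_self M).trans_lt h1
  · rw [Real.lt_sqrt (by norm_num)]
    push_cast
    nlinarith [(Nat.cast_nonneg N₀ : (0:ℝ) ≤ N₀), (Nat.cast_nonneg ⌈|M|⌉₊ : (0:ℝ) ≤ ⌈|M|⌉₊)]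

/-! ### Load-bearing: the RANDOM initial law (energy conservation alone is blind)

`EnergyCurrentTailsSure`: the crux with the expectation under the local Gibbs law replaced by a
sure statement over all configurations of bounded energy per particle (the only a priori
information the deterministic flow propagates).  FALSE: one sphere carrying the energy of all. -/

/-- The crux WITHOUT the random law: cubic uniform integrability for every configuration whose
kinetic energy per particle is at most `E₀`. -/
def EnergyCurrentTailsSure : Prop :=
  ∀ E₀ : ℝ, 0 < E₀ → ∀ ε : ℝ, 0 < ε → ∃ M : ℝ, ∃ N₀ : ℕ, ∀ N : ℕ, N₀ ≤ N →
    ∀ z : Config (N + 1) (Fin 3) T3,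
      ((N : ℝ) + 1)⁻¹ * ∑ i : Fin (N + 1), ‖(z i).2‖ ^ 2 ≤ E₀ → cubicTail N M z ≤ ε

/-- **Any proof must use the randomness of the data (energy conservation is blind to cubic
tails).**  Witness: `fastConfig N √(N+1)` has energy `1` per particle and cubic tail `√(N+1)`. -/
theorem energyCurrentTails_false_without_randomness : ¬ EnergyCurrentTailsSure := by
  intro h
  obtain ⟨M, N₀, hMN⟩ := h 1 one_pos 1 one_pos
  -- enlarge the cut-off to a nonnegative one (monotonicity is not needed: we pick N large)
  obtain ⟨N, hN₀, hMN', h2⟩ := exists_sqrt_gt (max M 0) N₀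
  have hM0 : (0 : ℝ) ≤ max M 0 := le_max_right _ _
  have key := hMN N hN₀ (fastConfig N (Real.sqrt ((N : ℝ) + 1))) (by
    rw [energy_fastConfig N _ (Real.sqrt_nonneg _), Real.sq_sqrt (by positivity),
      inv_mul_cancel₀ (by positivity)])
  -- the tail at cut-off `M` dominates the tail at cut-off `max M 0`
  have hmono : cubicTail N (max M 0) (fastConfig N (Real.sqrt ((N : ℝ) + 1))) ≤
      cubicTail N M (fastConfig N (Real.sqrt ((N : ℝ) + 1))) := by
    unfold cubicTail
    refine mul_le_mul_of_nonneg_left (Finset.sum_le_sum fun i _ => ?_) (by positivity)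
    unfold tail3
    refine Set.indicator_le_indicator_of_subset (fun v (hv : max M 0 < ‖v‖) => ?_)
      (fun v => by positivity) _
    exact (le_max_left M 0).trans_lt hv
  rw [cubicTail_fastConfig_sqrt hM0 hMN'] at hmono
  linarith


/-! ### §3b The same inside the hard-sphere domain (admissible, non-overlapping witnesses) -/

/-- `cubicTail` only depends on the velocities. -/
theorem cubicTail_congr_vel {N : ℕ} (M : ℝ) {z z' : Config (N + 1) (Fin 3) T3}
    (h : ∀ i, (z i).2 = (z' i).2) : cubicTail N M z = cubicTail N M z' := by
  unfold cubicTail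
  simp [h]

/-- The focusing configuration placed at prescribed (non-overlapping) positions `x`. -/
def fastConfigAt {N : ℕ} (x : Fin (N + 1) → T3) (V : ℝ) : Config (N + 1) (Fin 3) T3 :=
  zipConfig (x, fun i => if i = 0 then V • e0 else 0)

/-- The placed focusing configuration has the velocities of `fastConfig`. -/
theorem fastConfigAt_vel {N : ℕ} (x : Fin (N + 1) → T3) (V : ℝ) (i : Fin (N + 1)) :
    (fastConfigAt x V i).2 = (fastConfig N V i).2 := by
  simp [fastConfigAt, fastConfig]

/-- The placed focusing configuration is admissible when the positions are separated. -/
theorem fastConfigAt_mem {σ : ℝ} {N : ℕ} {x : Fin (N + 1) → T3}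
    (hx : ∀ i j, i ≠ j → hsDiameter σ N < Torus.euclidDist (x i) (x j)) (V : ℝ) :
    fastConfigAt x V ∈ hardSphereDomain (Torus.geometry (Fin 3)) (N + 1) (hsDiameter σ N) := by
  unfold fastConfigAt
  rw [zipConfig_mem_hardSphereDomain_iff]
  exact fun i j hij => (hx i j hij).le

/-- The crux WITHOUT the random law, over ADMISSIBLE configurations only (mutual distances
`≥ σ(N+1)^{-1/3}`) of kinetic energy `≤ E₀` per particle. -/
def EnergyCurrentTailsSureInDomain (σ : ℝ) : Prop :=
  ∀ E₀ : ℝ, 0 < E₀ → ∀ ε : ℝ, 0 < ε → ∃ M : ℝ, ∃ N₀ : ℕ, ∀ N : ℕ, N₀ ≤ N →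
    ∀ z ∈ hardSphereDomain (Torus.geometry (Fin 3)) (N + 1) (hsDiameter σ N),
      ((N : ℝ) + 1)⁻¹ * ∑ i : Fin (N + 1), ‖(z i).2‖ ^ 2 ≤ E₀ → cubicTail N M z ≤ ε

/-- **The sure version fails inside the hard-sphere domain too** (every `σ ≤ 1/2`, where admissible
positions exist for all `N`, `exists_config_hsDiameter_lt`): the hard core constrains positions,
not velocities. -/
theorem energyCurrentTails_false_without_randomness_inDomain {σ : ℝ} (hσ2 : σ ≤ 1 / 2) :
    ¬ EnergyCurrentTailsSureInDomain σ := by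
  intro h
  obtain ⟨M, N₀, hMN⟩ := h 1 one_pos 1 one_pos
  obtain ⟨N, hN₀, hMN', h2⟩ := exists_sqrt_gt (max M 0) N₀
  have hM0 : (0 : ℝ) ≤ max M 0 := le_max_right _ _
  obtain ⟨x, hx⟩ := exists_config_hsDiameter_lt hσ2 N
  have hvel : ∀ i, (fastConfigAt x (Real.sqrt ((N : ℝ) + 1)) i).2 =
      (fastConfig N (Real.sqrt ((N : ℝ) + 1)) i).2 := fastConfigAt_vel x _
  have henergy : ((N : ℝ) + 1)⁻¹ *
      ∑ i : Fin (N + 1), ‖(fastConfigAt x (Real.sqrt ((N : ℝ) + 1)) i).2‖ ^ 2 ≤ 1 := by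
    simp_rw [hvel]
    rw [energy_fastConfig N _ (Real.sqrt_nonneg _), Real.sq_sqrt (by positivity),
      inv_mul_cancel₀ (by positivity)]
  have key := hMN N hN₀ (fastConfigAt x (Real.sqrt ((N : ℝ) + 1))) (fastConfigAt_mem hx _) henergy
  rw [cubicTail_congr_vel M hvel] at key
  have hmono : cubicTail N (max M 0) (fastConfig N (Real.sqrt ((N : ℝ) + 1))) ≤
      cubicTail N M (fastConfig N (Real.sqrt ((N : ℝ) + 1))) := by
    unfold cubicTail
    refine mul_le_mul_of_nonneg_left (Finset.sum_le_sum fun i _ => ?_) (by positivity)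
    unfold tail3
    refine Set.indicator_le_indicator_of_subset (fun v (hv : max M 0 < ‖v‖) => ?_)
      (fun v => by positivity) _
    exact (le_max_left M 0).trans_lt hv
  rw [cubicTail_fastConfig_sqrt hM0 hMN'] at hmono
  linarith

/-! ### Load-bearing: the GAUSSIAN velocity law (quadratic UI does not give cubic UI)

`EnergyCurrentTailsOfQuadraticUI`: for families of probability laws on phase space, uniform
integrability of the KINETIC ENERGY (all that energy conservation, the `O(N)` entropy bound and the
convergence of the hydrodynamic fields can see) implies uniform integrability of the cubic
current.  FALSE: the two-point laws `(1 - q_N) δ_rest + q_N δ_fast`, `q_N = (N+1)^{-1/2}`, have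
quadratic tails `≤ q_N → 0` at every cut-off and cubic tails `= 1` at every cut-off. -/

/-- The crux WITHOUT the Gibbsian form of the law: cubic UI from quadratic UI. -/
def EnergyCurrentTailsOfQuadraticUI : Prop :=
  ∀ P : (N : ℕ) → Measure (Config (N + 1) (Fin 3) T3), (∀ N, IsProbabilityMeasure (P N)) →
    (∀ ε : ℝ, 0 < ε → ∃ M : ℝ, ∃ N₀ : ℕ, ∀ N : ℕ, N₀ ≤ N →
        ∫⁻ z, ENNReal.ofReal (quadTail N M z) ∂(P N) ≤ ENNReal.ofReal ε) →
    ∀ ε : ℝ, 0 < ε → ∃ M : ℝ, ∃ N₀ : ℕ, ∀ N : ℕ, N₀ ≤ N →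
        ∫⁻ z, ENNReal.ofReal (cubicTail N M z) ∂(P N) ≤ ENNReal.ofReal ε

/-- The mixing weight `q_N = (√(N+1))⁻¹ ∈ (0, 1]`. -/
def qN (N : ℕ) : ℝ := (Real.sqrt ((N : ℝ) + 1))⁻¹

/-- The mixing weight is positive. -/
theorem qN_pos (N : ℕ) : 0 < qN N := inv_pos.2 (Real.sqrt_pos.2 (by positivity))

/-- The mixing weight is at most one. -/
theorem qN_le_one (N : ℕ) : qN N ≤ 1 := by
  unfold qN
  refine inv_le_one_of_one_le₀ ?_
  rw [show (1 : ℝ) = Real.sqrt 1 by simp]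
  exact Real.sqrt_le_sqrt (by simp)

/-- `q_N √(N+1) = 1`. -/
theorem qN_mul_sqrt (N : ℕ) : qN N * Real.sqrt ((N : ℝ) + 1) = 1 :=
  inv_mul_cancel₀ (Real.sqrt_pos.2 (by positivity)).ne'

/-- The two-point focusing law. -/
def twoPointLaw (N : ℕ) : Measure (Config (N + 1) (Fin 3) T3) :=
  ENNReal.ofReal (1 - qN N) • Measure.dirac (restConfig N) +
    ENNReal.ofReal (qN N) • Measure.dirac (fastConfig N (Real.sqrt ((N : ℝ) + 1)))

/-- The two-point law is a probability measure. -/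
instance isProbabilityMeasure_twoPointLaw (N : ℕ) : IsProbabilityMeasure (twoPointLaw N) := by
  refine ⟨?_⟩
  simp only [twoPointLaw, Measure.coe_add, Measure.coe_smul, Pi.add_apply, Pi.smul_apply,
    measure_univ, smul_eq_mul, mul_one]
  rw [← ENNReal.ofReal_add (by linarith [qN_le_one N]) (qN_pos N).le]
  simp

/-- Integration against the two-point law. -/
theorem lintegral_twoPointLaw (N : ℕ) (f : Config (N + 1) (Fin 3) T3 → ℝ≥0∞) :
    ∫⁻ z, f z ∂(twoPointLaw N) =
      ENNReal.ofReal (1 - qN N) * f (restConfig N) +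
        ENNReal.ofReal (qN N) * f (fastConfig N (Real.sqrt ((N : ℝ) + 1))) := by
  simp only [twoPointLaw, lintegral_add_measure, lintegral_smul_measure, lintegral_dirac,
    smul_eq_mul]

/-- Quadratic tails of the two-point laws are `≤ q_N` at every nonnegative cut-off. -/
theorem lintegral_quadTail_twoPointLaw_le (N : ℕ) {M : ℝ} (hM : 0 ≤ M) :
    ∫⁻ z, ENNReal.ofReal (quadTail N M z) ∂(twoPointLaw N) ≤ ENNReal.ofReal (qN N) := by
  rw [lintegral_twoPointLaw, quadTail_restConfig N hM, ENNReal.ofReal_zero, mul_zero, zero_add]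
  calc ENNReal.ofReal (qN N) * ENNReal.ofReal (quadTail N M (fastConfig N (Real.sqrt ((N : ℝ) + 1))))
      ≤ ENNReal.ofReal (qN N) * 1 := by
        gcongr
        rw [← ENNReal.ofReal_one]
        refine ENNReal.ofReal_le_ofReal ((quadTail_fastConfig_le hM (Real.sqrt_nonneg _)).trans ?_)
        rw [Real.sq_sqrt (by positivity), inv_mul_cancel₀ (by positivity)]
    _ = ENNReal.ofReal (qN N) := mul_one _

/-- Cubic tails of the two-point laws are exactly `1` below the fast speed. -/
theorem lintegral_cubicTail_twoPointLaw (N : ℕ) {M : ℝ} (hM : 0 ≤ M)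
    (hMN : M < Real.sqrt ((N : ℝ) + 1)) :
    ∫⁻ z, ENNReal.ofReal (cubicTail N M z) ∂(twoPointLaw N) = 1 := by
  rw [lintegral_twoPointLaw, cubicTail_restConfig N hM, ENNReal.ofReal_zero, mul_zero, zero_add,
    cubicTail_fastConfig_sqrt hM hMN, ← ENNReal.ofReal_mul (qN_pos N).le, qN_mul_sqrt,
    ENNReal.ofReal_one]

/-- `q_N ≤ ε` once `N ≥ ⌈ε⁻²⌉`. -/
theorem qN_le_of_le {ε : ℝ} (hε : 0 < ε) {N : ℕ} (hN : ⌈ε⁻¹ ^ 2⌉₊ ≤ N) : qN N ≤ ε := by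
  unfold qN
  have hε1 : ε⁻¹ ≤ Real.sqrt ((N : ℝ) + 1) := by
    rw [Real.le_sqrt (inv_pos.2 hε).le (by positivity)]
    have : (⌈ε⁻¹ ^ 2⌉₊ : ℝ) ≤ N := by exact_mod_cast hN
    linarith [Nat.le_ceil (ε⁻¹ ^ 2)]
  calc (Real.sqrt ((N : ℝ) + 1))⁻¹ ≤ (ε⁻¹)⁻¹ := inv_anti₀ (inv_pos.2 hε) hε1
    _ = ε := inv_inv ε

/-- **Any proof must use more of the local Gibbs law than the uniform integrability of the
kinetic energy.**  The two-point focusing laws satisfy quadratic UI and violate cubic UI. -/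
theorem energyCurrentTails_false_of_quadraticUI_only : ¬ EnergyCurrentTailsOfQuadraticUI := by
  intro h
  have hq : ∀ ε : ℝ, 0 < ε → ∃ M : ℝ, ∃ N₀ : ℕ, ∀ N : ℕ, N₀ ≤ N →
      ∫⁻ z, ENNReal.ofReal (quadTail N M z) ∂(twoPointLaw N) ≤ ENNReal.ofReal ε := by
    intro ε hε
    refine ⟨0, ⌈ε⁻¹ ^ 2⌉₊, fun N hN => ?_⟩
    exact (lintegral_quadTail_twoPointLaw_le N le_rfl).trans
      (ENNReal.ofReal_le_ofReal (qN_le_of_le hε hN))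
  obtain ⟨M, N₀, hMN⟩ := h twoPointLaw (fun N => isProbabilityMeasure_twoPointLaw N) hq
    (1 / 2) (by norm_num)
  obtain ⟨N, hN₀, hMN', -⟩ := exists_sqrt_gt (max M 0) N₀
  have key := hMN N hN₀
  -- monotonicity of the tail in the cut-off: replace `M` by `max M 0`
  have hmono : ∫⁻ z, ENNReal.ofReal (cubicTail N (max M 0) z) ∂(twoPointLaw N) ≤
      ∫⁻ z, ENNReal.ofReal (cubicTail N M z) ∂(twoPointLaw N) := by
    refine lintegral_mono fun z => ENNReal.ofReal_le_ofReal ?_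
    unfold cubicTail
    refine mul_le_mul_of_nonneg_left (Finset.sum_le_sum fun i _ => ?_) (by positivity)
    unfold tail3
    refine Set.indicator_le_indicator_of_subset (fun v (hv : max M 0 < ‖v‖) => ?_)
      (fun v => by positivity) _
    exact (le_max_left M 0).trans_lt hv
  rw [lintegral_cubicTail_twoPointLaw N (le_max_right M 0) hMN'] at hmono
  have : (1 : ℝ≥0∞) ≤ ENNReal.ofReal (1 / 2) := hmono.trans key
  rw [← ENNReal.ofReal_one] at this
  have := (ENNReal.ofReal_le_ofReal_iff (by norm_num)).1 this
  norm_num at this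


end EnergyCurrentTailsNegative

end Summit.AtomisticToContinuum.HydrodynamicLimit.Theorems

end
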